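import Mathlib
import Literature.NumberTheory.Automorphic.HilbertModularFormQExpansion
import Summits.Langlands.Langlands.Theorems.CapacityClassicalityHilbertIntegralOverconvergentIsCongruenceKoecherPrinciple

/-!
# The `V_δ` operator `f ↦ f(δ·)` on Hilbert modular forms (stub U1 of line Sketch-ideate-r1-k1)

Stub `stub_smulArg_modular` (U1) of section U of line Sketch-ideate-r1-k1 for the crux
`HilbertIntegralOverconvergentIsCongruence` (stmt-Langlands-8485): for a totally positive `δ ∈ 𝓞 F`
and a Hilbert modular form `f ∈ M_k(Γ₁(𝔫))` over a totally real field `F` of degree `≥ 2`, the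
function `z ↦ f(δz)`, `(δz)_σ = σ(δ) z_σ`, lies in `M_k(Γ₁(𝔫δ))`.  Proof: the coordinatewise rescaling
by `σ(δ) > 0` is `ℂ`-linear and preserves `ℍ` and its complement, so `f(δ·)` is holomorphic on `ℍ` and
`0` off `ℍ`; for `γ = (a b; c d) ∈ Γ₁(𝔫δ)` one writes `c = c'δ` with `c' ∈ 𝔫` and puts
`γ' = (a bδ; c' d) ∈ Γ₁(𝔫)`, for which `γ'(δz) = δ(γz)` and `J_k(γ', δz) = J_k(γ, z)`, so the
weight-`k` law of `f` under `γ'` at `δz` is the law of `f(δ·)` under `γ` at `z`; the cusp condition is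
supplied by the landed Koecher principle (`koecherPrinciple`, `[F:ℚ] ≥ 2`, `Γ₁(𝔫δ) ⊇ Γ(𝔫δ)`,
`𝔫δ ≠ 0` as `δ ≠ 0`).
-/

set_option linter.dupNamespace false

noncomputable section

namespace Summit.Langlands.Langlands.Theorems.HilbertIntegralOverconvergentIsCongruence

open MeasureTheory Complex NumberField
open Literature.NumberTheory.Automorphic Literature.NumberTheory.Automorphic.HilbertModular
open scoped MatrixGroups

variable {F : Type} [Field F] [NumberField F]

omit [NumberField F] in
/-- For `δ` totally positive, the rescaling `z ↦ (σ(δ) z_σ)_σ` preserves `ℍ` and its complement: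
`Im (σ(δ) z_σ) = σ(δ) Im z_σ`. -/
theorem sam_smul_mem_halfSpace_iff (δ : 𝓞 F) (hδ : ∀ σ : F →+* ℝ, 0 < σ (δ : F)) (z : Point F) :
    (fun σ ↦ ((σ (δ : F) : ℝ) : ℂ) * z σ) ∈ halfSpace F ↔ z ∈ halfSpace F := by
  simp only [mem_halfSpace_iff, Complex.im_ofReal_mul]
  exact forall_congr' fun σ ↦ mul_pos_iff_of_pos_left (hδ σ)

/-- The coordinatewise rescaling `z ↦ (c_σ z_σ)_σ` is `ℂ`-differentiable on `ℂ^{Hom(F,ℝ)}`. -/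
theorem sam_differentiable_smul (c : (F →+* ℝ) → ℂ) :
    Differentiable ℂ fun z : Point F ↦ fun σ ↦ c σ * z σ :=
  differentiable_pi.2 fun σ ↦ (differentiable_apply σ).const_mul (c σ)

omit [NumberField F] in
/-- Entries of the image in `SL₂(F)` of `γ ∈ SL₂(𝓞 F)`. -/
theorem sam_toSL2F_apply (γ : SL(2, 𝓞 F)) (i j : Fin 2) :
    (toSL2F γ : SL(2, F)) i j = ((γ i j : 𝓞 F) : F) :=
  rfl

/-- For `γ = (a b; c'δ d)` and `γ' = (a bδ; c' d)` in `SL₂(𝓞 F)`: `γ'(δz) = δ(γz)` and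
`J_k(γ', δz) = J_k(γ, z)` (the denominators `σ(c')σ(δ)z_σ + σ(d)` agree, the numerators differ by
the factor `σ(δ)`). -/
theorem sam_moeb_autFactor_smul (k : (F →+* ℝ) → ℤ) (δ c' : 𝓞 F) (γ γ' : SL(2, 𝓞 F))
    (h00 : γ' 0 0 = γ 0 0) (h01 : γ' 0 1 = γ 0 1 * δ) (h10 : γ' 1 0 = c') (h10' : γ 1 0 = c' * δ)
    (h11 : γ' 1 1 = γ 1 1) (z : Point F) :
    moeb (toSL2F γ') (fun σ ↦ ((σ (δ : F) : ℝ) : ℂ) * z σ) =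
        (fun σ ↦ ((σ (δ : F) : ℝ) : ℂ) * moeb (toSL2F γ) z σ) ∧
      autFactor k (toSL2F γ') (fun σ ↦ ((σ (δ : F) : ℝ) : ℂ) * z σ) = autFactor k (toSL2F γ) z := by
  have hden : ∀ σ, denom (toSL2F γ') (fun σ ↦ ((σ (δ : F) : ℝ) : ℂ) * z σ) σ = denom (toSL2F γ) z σ := by
    intro σ
    simp only [denom, sam_toSL2F_apply, h10, h10', h11, map_mul, Complex.ofReal_mul]
    ring
  refine ⟨funext fun σ ↦ ?_, ?_⟩
  · simp only [moeb]
    rw [hden σ]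
    simp only [sam_toSL2F_apply, h00, h01, map_mul, Complex.ofReal_mul]
    ring
  · simp only [autFactor, hden]

/-- **stub U1 — `stub_smulArg_modular` (the `V_δ` operator).** For a totally positive `δ ∈ 𝓞 F` and
`f ∈ M_k(Γ₁(𝔫))` over a totally real field of degree `≥ 2` (`𝔫 ≠ 0`), the function `z ↦ f(δz)`
(`(δz)_σ = σ(δ) z_σ`) lies in `M_k(Γ₁(𝔫δ))`: it is holomorphic on `ℍ` and `0` off `ℍ` (`δ` preserves
`ℍ` and its complement); for `γ = (a b; c d) ∈ Γ₁(𝔫δ)` one has `c = c'δ` with `c' ∈ 𝔫`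
(`Ideal.mem_mul_span_singleton`), `γ' := (a bδ; c' d) ∈ Γ₁(𝔫)`, `γ'(δz) = δ(γz)` and
`J_k(γ', δz) = J_k(γ, z)`, so the weight-`k` law of `f` under `γ'` at `δz` is the law of `f(δ·)`
under `γ` at `z`; the cusp condition is automatic by the Koecher principle (`koecherPrinciple`,
`[F:ℚ] ≥ 2`, `Γ₁(𝔫δ) ⊇ Γ(𝔫δ)`, `𝔫δ ≠ 0`). [folklore] -/
theorem stub_smulArg_modular (F : Type) [Field F] [NumberField F] [NumberField.IsTotallyReal F]
    (hd : 1 < Module.finrank ℚ F) (𝔫 : Ideal (𝓞 F)) (h𝔫 : 𝔫 ≠ ⊥) (k : (F →+* ℝ) → ℤ) (f : Point F → ℂ)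
    (hf : f ∈ modularForms (Bianchi.Gamma1 𝔫) k) (δ : 𝓞 F) (hδ : ∀ σ : F →+* ℝ, 0 < σ (δ : F)) :
    (fun z : Point F ↦ f (fun σ ↦ ((σ (δ : F) : ℝ) : ℂ) * z σ)) ∈
      modularForms (Bianchi.Gamma1 (𝔫 * Ideal.span {δ})) k := by
  have hf' : IsModularForm (Bianchi.Gamma1 𝔫) k f := mem_modularForms_iff.mp hf
  -- `δ ≠ 0` (test `hδ` at a real embedding: any complex embedding of `F` is real), so `𝔫δ ≠ 0`
  have hδ0 : δ ≠ 0 := by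
    rintro rfl
    exact (hδ (IsTotallyReal.complexEmbedding_isReal (Classical.arbitrary (F →+* ℂ))).embedding).ne'
      (by simp)
  have hne : 𝔫 * Ideal.span {δ} ≠ ⊥ := by
    rw [Ne, Ideal.mul_eq_bot, Ideal.span_singleton_eq_bot, not_or]
    exact ⟨h𝔫, hδ0⟩
  refine mem_modularForms_iff.mpr (koecherPrinciple F hd (𝔫 * Ideal.span {δ}) hne
    (Bianchi.Gamma1 (𝔫 * Ideal.span {δ})) (Bianchi.Gamma_le_Gamma1 _) k
    (fun z : Point F ↦ f (fun σ ↦ ((σ (δ : F) : ℝ) : ℂ) * z σ)) ?_ ?_ ?_)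
  · -- holomorphy: `f ∘ (δ·)` with `δ·` linear and `ℍ`-preserving
    exact hf'.holomorphic.comp (sam_differentiable_smul _).differentiableOn
      fun z hz ↦ (sam_smul_mem_halfSpace_iff δ hδ z).2 hz
  · -- the weight-`k` law under `Γ₁(𝔫δ)`
    intro γ hγ z hz
    obtain ⟨hc, hd1⟩ := Bianchi.mem_Gamma1.mp hγ
    obtain ⟨c', hc'𝔫, hc'⟩ := Ideal.mem_mul_span_singleton.mp hc
    have hdet : γ 0 0 * γ 1 1 - γ 0 1 * γ 1 0 = 1 := by
      have h := γ.det_coe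
      rwa [Matrix.det_fin_two] at h
    have hdet' : Matrix.det !![γ 0 0, γ 0 1 * δ; c', γ 1 1] = 1 := by
      rw [Matrix.det_fin_two_of]
      linear_combination hdet - (γ 0 1) * hc'
    obtain ⟨γ', h00, h01, h10, h11⟩ : ∃ γ' : SL(2, 𝓞 F),
        γ' 0 0 = γ 0 0 ∧ γ' 0 1 = γ 0 1 * δ ∧ γ' 1 0 = c' ∧ γ' 1 1 = γ 1 1 :=
      ⟨⟨!![γ 0 0, γ 0 1 * δ; c', γ 1 1], hdet'⟩, rfl, rfl, rfl, rfl⟩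
    have hγ' : γ' ∈ Bianchi.Gamma1 𝔫 := by
      refine Bianchi.mem_Gamma1.mpr ⟨?_, ?_⟩
      · rw [h10]
        exact hc'𝔫
      · rw [h11]
        exact Ideal.mul_le_right hd1
    obtain ⟨hmoeb, haut⟩ := sam_moeb_autFactor_smul k δ c' γ γ' h00 h01 h10 hc'.symm h11 z
    have key := hf'.transform γ' hγ' (fun σ ↦ ((σ (δ : F) : ℝ) : ℂ) * z σ)
      ((sam_smul_mem_halfSpace_iff δ hδ z).2 hz)
    rw [hmoeb, haut] at key
    exact key
  · -- `0` off `ℍ`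
    intro z hz
    exact hf'.eq_zero _ (mt (sam_smul_mem_halfSpace_iff δ hδ z).1 hz)

end Summit.Langlands.Langlands.Theorems.HilbertIntegralOverconvergentIsCongruence
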